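import Literature.AlgebraicGeometry.AbelianSchemes.AbelianSchemeConstSubgroupStableCover
import Literature.AlgebraicGeometry.Morphisms.QuasiProjectiveFinsetAffineOpen
import HarnessLib

/-!
# The `hcov` binder of the quotient chain for a QUASI-PROJECTIVE abelian scheme (HECKE-LINK, (cov-1)+(cov-2q) wired)

Layer `Literature/AlgebraicGeometry/AbelianSchemes`, namespace `Literature.AlgebraicGeometry.AbelianSchemes.AbelianSchemeOver`.
Cell `hodgecm-mathlib`, HECKE-LINK line: ★ (cov-1) `AbelianSchemeConstSubgroupStableCover` (p750194: `hcov` from «finite sets of points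
lie in affine opens») + ★ (cov-2q) `Morphisms/QuasiProjectiveFinsetAffineOpen` (p751195, B-p10 (g10): that input for quasi-projective
`k`-schemes) ⇒ for an abelian scheme `A → S` over a field `k` (`sk : S → Spec k`) whose TOTAL SPACE is quasi-projective over `k`, and
any finite subgroup `K ≤ A(S)`, the `K`-stable cover hypothesis `hcov` of ★ file (i) (`u := sk`, `Y := Spec k` affine) HOLDS:
`translationActionOver_hcov_of_isQuasiProjectiveOver`.  [MumfordAV1970] §7 Thm. p. 66 (proof).  ONE THEOREM; no definition, no
instance, no sorry.  Remaining input at the Hecke instantiation: quasi-projectivity of the `S″`-family and of its dual ((cov-3)).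
HC_CM is proved only modulo the 7 printed citations until rung 0 closes; nothing here is about HC.

## References
* [MumfordAV1970] D. Mumford, *Abelian Varieties* (1970), §7 Thm. p. 66 (proof).
-/

noncomputable section

universe u

open CategoryTheory CategoryTheory.Limits AlgebraicGeometry MonoidalCategory CartesianMonoidalCategory
open scoped MonObj

namespace Literature.AlgebraicGeometry.AbelianSchemes

namespace AbelianSchemeOver

open Literature.AlgebraicGeometry.RelativeSpec

/-- **`hcov` for a quasi-projective total space**: if `A.left`, as a `k`-scheme via `A → S → Spec k`, is quasi-projective over `k`,
then every point of `A` has a `K`-stable open neighbourhood affine over `Spec k`, for every finite subgroup `K ≤ A(S)` (★ (cov-1)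
p750194 + ★ (cov-2q) p751195). [cite: MumfordAV1970, §7 Thm. p. 66 (proof)] -/
theorem translationActionOver_hcov_of_isQuasiProjectiveOver {k : Type u} [Field k] {S : Scheme.{u}} (A : AbelianSchemeOver S)
    (sk : S ⟶ Spec (.of k)) (K : Subgroup A.Sections) [Finite K] [IsSeparated (A.X.hom ≫ sk)]
    (hX : HodgeTheory.IsQuasiProjectiveOver (Over.mk (A.X.hom ≫ sk) : Motives.SchemeOver k)) :
    ∀ x : A.left, ∃ O : (A.translationActionOver sk K).StableAffineOpens, x ∈ O.1 :=
  A.translationActionOver_hcov_of_forall_finset sk K fun s =>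
    Morphisms.exists_isAffineOpen_forall_mem_of_isQuasiProjectiveOver (X := (Over.mk (A.X.hom ≫ sk) : Motives.SchemeOver k)) hX s

end AbelianSchemeOver

end Literature.AlgebraicGeometry.AbelianSchemes

end
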